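import Mathlib
import Summits.AnomalousDissipation.AnomalousDissipation.Theorems.SoloBlindVolterraRepr
import Summits.AnomalousDissipation.AnomalousDissipation.Theorems.SoloBlindBackwardGronwall

/-!
# SoloBlind — the discrete LG error theorem, algebraic form ([O1-LG], PLAN §119.12)

Composition of the finite-horizon Volterra inequality (`SoloBlindVolterraRepr.volterra_ineq`) with the backward
discrete Gronwall lemma (`SoloBlindBackwardGronwall`): for `w = P (1 + ε)` solving the three-term recurrence
`w (k+2) = β (k+1) w (k+1) - w k`, normalised at the horizon (`ε N = ε (N+1) = 0`), with non-vanishing comparison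
sequence `P`, one-step residuals `r`, and uniform inner-sum bounds `B j`,

  `‖ε k‖ ≤ exp ( ∑_{j ∈ [k, N)} ‖r (j+1)‖ / ‖P (j+1)‖ · B j ) - 1`     for all `k ≤ N`.

The analytic content of [O1] is thereby reduced to two explicit 1-D estimates (Lemma A: the `B j`, via
`SoloBlindAbelBound` + `SoloBlindInnerSum`; Lemma B: the residual sum), see the notes.
-/

namespace Summit.AnomalousDissipation.SoloBlind.LGError

open Finset
open Summit.AnomalousDissipation.SoloBlind

/-- Discrete LG error bound (algebraic form): Volterra inequality + backward Gronwall. -/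
theorem lg_error (w P ε β r : ℕ → ℂ) (B : ℕ → ℝ)
    (hw : ∀ k, w k = P k * (1 + ε k))
    (hrec : ∀ k, w (k + 2) = β (k + 1) * w (k + 1) - w k)
    (hr : ∀ k, r (k + 1) = P (k + 2) - β (k + 1) * P (k + 1) + P k)
    (hP : ∀ k, P k ≠ 0) (N : ℕ) (hN : ε N = 0) (hN1 : ε (N + 1) = 0)
    (hB0 : ∀ j, 0 ≤ B j)
    (hB : ∀ k j, k ≤ j → j < N → ‖P (j + 1) ^ 2 * ∑ i ∈ Icc k j, 1 / (P i * P (i + 1))‖ ≤ B j)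
    (k : ℕ) (hk : k ≤ N) :
    ‖ε k‖ ≤ Real.exp (∑ j ∈ Ico k N, ‖r (j + 1)‖ / ‖P (j + 1)‖ * B j) - 1 := by
  -- the Gronwall weights, shifted by one: κ j = κ' (j-1)
  set κ' : ℕ → ℝ := fun j => ‖r (j + 1)‖ / ‖P (j + 1)‖ * B j with hκ'
  set κ : ℕ → ℝ := fun j => κ' (j - 1) with hκ
  have hκnn : ∀ j, 0 ≤ κ j := fun j =>
    mul_nonneg (div_nonneg (norm_nonneg _) (norm_nonneg _)) (hB0 _)
  -- Volterra inequality in Gronwall's indexing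
  have hV : ∀ m, m < N → ‖ε m‖ ≤ ∑ j ∈ Ico (m + 1) (N + 1), κ j * (1 + ‖ε j‖) := by
    intro m hm
    have h := VolterraRepr.volterra_ineq w P ε β r B hw hrec hr hP N hN hN1 hB m hm.le
    have hshift : ∑ j ∈ Ico m N, κ' j * (1 + ‖ε (j + 1)‖) = ∑ j ∈ Ico (m + 1) (N + 1), κ j * (1 + ‖ε j‖) := by
      rw [← Finset.sum_Ico_add' (fun j => κ j * (1 + ‖ε j‖)) m N 1]
      refine Finset.sum_congr rfl (fun j _ => ?_)
      simp [hκ]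
    rw [← hshift]
    exact h
  have hG := BackwardGronwall.backward_gronwall ε κ N hκnn hN hV k hk
  have hE := BackwardGronwall.prod_one_add_le_exp_sum κ (Ico (k + 1) (N + 1)) hκnn
  have hshift2 : ∑ j ∈ Ico (k + 1) (N + 1), κ j = ∑ j ∈ Ico k N, κ' j := by
    rw [← Finset.sum_Ico_add' (fun j => κ j) k N 1]
    refine Finset.sum_congr rfl (fun j _ => ?_)
    simp [hκ]
  rw [hshift2] at hE
  exact hG.trans hE

end Summit.AnomalousDissipation.SoloBlind.LGError
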